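import Summits.BirchSwinnertonDyer.BirchSwinnertonDyer.Theorems.PrintCFramBottomClassIndexLawFiveLeEisensteinLineDataOfPrint
import Summits.BirchSwinnertonDyer.BirchSwinnertonDyer.Theorems.PrintCFramBottomClassIndexLawFiveLeEisensteinMatchAnatomy
import Summits.BirchSwinnertonDyer.BirchSwinnertonDyer.Theorems.PrintCFramBottomClassIndexLawFiveLeEisensteinUpgradeOfModuleInvariants
import HarnessLib

/-!
# Route `PrintCFram`, crux C2 `BottomClassIndexLawFiveLe` (stmt-BirchSwinnertonDyer-20372), line
# `eisenstein-resource-bdp-line`, skeleton v4 (sha16 fefbf6bba78d6cf1): WHERE THE NEW STUB `stub_analyticInequality_cmRamified`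
# ((AN)) SITS — between the Euler-system inclusion and the IMC equality — and its Greenberg–Vatsal socket
# (cell `bsd-print-cfram`, seat `bsd-line-cfram-p1` LEAD g4; helper `--supports` 20372; 0 defs, 0 facts minted)

HONEST FRAMING. Nothing about BSD is proved; no stub is closed. Pure bookkeeping over `𝓞_{ℂ_p}⟦T⟧` plus the landed line data:
* §1 `le_order_map_residue_of_mem_map_span` — over local rings `R → S` (a map detecting the maximal ideals): an element of
  the extended principal ideal `(g)·S⟦X⟧` has residual order `≥ ord ḡ`.
* §2 `coeff_norm_lt_one_of_span_le_map_charIdeal` — for a f.g. TORSION `Λ`-module `X` and `Q ∈ 𝓞_{ℂ_p}⟦T⟧`: the UPPER inclusion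
  `(Q) ⊆ char_Λ(X)·𝓞_{ℂ_p}⟦T⟧` (the Euler-system / Kolyvagin direction of a main conjecture) already gives (AN) «the first `λ(X)`
  coefficients of `Q` are non-units» (char generator `p^μ g₀`, `ord ḡ₀ = λ`). So (AN) is WEAKER than the upper inclusion.
* §3 on the crux binders: `stub_analyticInequality_cmRamified_of_prop14_of_upperIncl` — REGISTERED (AN) VERBATIM ⟸ CGLS Prop. 14
  (torsion, p625055) ∧ the upper inclusion at every frame; `stub_analyticInequality_cmRamified_of_GV` — REGISTERED (AN) VERBATIM ⟸
  the Greenberg–Vatsal comparison data at every frame (a congruence `Q ≡ u·L₁·L₂ (mod 𝔪)` with a unit `u`, residual-order bounds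
  `ord L̄ᵢ ≥ nᵢ`, and the algebraic inequality `λ(X_(∅,0)) ≤ n₁ + n₂`) — the shape in which the (an-inv)/(alg-inv) halves of CGLS
  §3.3 would discharge it; `flatIMCEq_cmRamified_of_prop14_of_flatIncl_of_analyticInequality` — with β1, the ♭-IMC EQUALITY
  `char_Λ(X_(∅,0))·𝓞_{ℂ_p}⟦T⟧ = (Q)` at every frame ⟸ CGLS Prop. 14 ∧ β1 ∧ (AN) (the `hEq` socket of the row kernel, by name).
So on the CM-ramified rows the line's research content is exactly the two inclusions of the ♭-(∅,0) main conjecture for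
`f_W/K''`: β1 (lower, Eisenstein side) and — strictly weaker than the upper one — (AN). THEOREMS ONLY; no definition, no named
fact, no `sorry`. BSD is not proved by any of this; no summit statement is proved by this seat.
References: [GreenbergVatsal2000] §1 (1)–(2), Thm. (1.3), (17); [CastellaGrossiLeeSkinner2022] Thm. 3.2.1, §3.3, proof of
Thm. 5.1.1 (arXiv:2008.02571); [Washington1997] §13.2.
-/

set_option autoImplicit false
-- `…BirchSwinnertonDyer.BirchSwinnertonDyer.Theorems…` is the problem's mandated namespace (D-0017).
set_option linter.dupNamespace false

noncomputable section

open scoped Classical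

namespace Summit.BirchSwinnertonDyer.BirchSwinnertonDyer.Theorems.PrintCFram.EisensteinResourceBdpLine

open WeierstrassCurve NumberField IsDedekindDomain Field PowerSeries IsLocalRing
  Literature.NumberTheory.EllipticCurves Literature.NumberTheory.EllipticCurves.GreenbergSelmer
  Literature.NumberTheory.EllipticCurves.ModularForms Literature.NumberTheory.EllipticCurves.Rank1Residual
  Literature.NumberTheory.EllipticCurves.IwasawaAlgebra
  Literature.NumberTheory.GaloisRepresentations
  Summit.BirchSwinnertonDyer.BirchSwinnertonDyer.Theorems.SchneiderFree
  Summit.BirchSwinnertonDyer.Rank1Residual Summit.BirchSwinnertonDyer.Rank1Residual.X11b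
  Summit.BirchSwinnertonDyer.Rank1Residual.X11b.AcSelmer
  Summit.BirchSwinnertonDyer.BirchSwinnertonDyer.Theorems.PrintCFram.EisensteinMatchAnatomy

/-! ## §1 Residual order inside an extended principal ideal -/

/-- **An element of `(g)·S⟦X⟧` has residual order `≥ ord ḡ`**, for a ring map `J : R → S` of local rings detecting the maximal
ideals (`J a ∈ 𝔪_S ↔ a ∈ 𝔪_R`): if `Q ∈ (Ideal.span {g}).map (PowerSeries.map J)` then
`ord (ḡ) ≤ ord (Q̄)` (`Q = J(g)·h`, `ord` is super-additive, and `ord` of `J(g)‾` equals `ord ḡ`).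
[cite: GreenbergVatsal2000, §1 p. 18, (1)–(2) (μ, λ of a power series; independent of the coefficient ring)] -/
theorem le_order_map_residue_of_mem_map_span {R S : Type*} [CommRing R] [IsLocalRing R] [CommRing S] [IsLocalRing S]
    (J : R →+* S) (hJ : ∀ a : R, J a ∈ maximalIdeal S ↔ a ∈ maximalIdeal R) {g : R⟦X⟧} {Q : S⟦X⟧}
    (hQ : Q ∈ (Ideal.span {g}).map (PowerSeries.map J)) :
    (PowerSeries.map (residue R) g).order ≤ (PowerSeries.map (residue S) Q).order := by
  rw [Ideal.map_span, Set.image_singleton, Ideal.mem_span_singleton] at hQ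
  obtain ⟨h, rfl⟩ := hQ
  rw [← Literature.RingTheory.PowerSeries.order_map_residue_map_eq_of_mem_maximalIdeal_iff J hJ g, map_mul]
  exact le_trans le_self_add (PowerSeries.le_order_mul _ _)

/-! ## §2 The upper inclusion already gives (AN) -/

section Upper

variable {p : ℕ} [Fact p.Prime]

/-- **(AN) ⟸ the UPPER inclusion.** For a finitely generated torsion `Λ = ℤ_p⟦T⟧`-module `X` and `Q ∈ 𝓞_{ℂ_p}⟦T⟧` with
`(Q) ⊆ char_Λ(X)·𝓞_{ℂ_p}⟦T⟧`: every coefficient of `Q` below degree `λ(X)` has norm `< 1`. Proof: `char(X) = (p^{μ} g₀)` with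
`ord ḡ₀ = λ(X)` (Washington §13.2, tree `exists_charIdeal_eq_span_C_pow_mu_mul`), so `ord Q̄ ≥ ord (p^μ g₀)‾ ≥ ord ḡ₀ = λ(X)`
(§1 along `ℤ_p → 𝓞_{ℂ_p}`, `toCpInt_mem_maximalIdeal_iff`), and coefficients below the residual order are non-units.
[cite: Washington1997, §13.2] [cite: GreenbergVatsal2000, §1 p. 18, (1)–(2)] -/
theorem coeff_norm_lt_one_of_span_le_map_charIdeal (X : Type*) [AddCommGroup X] [Module (IwasawaAlgebra p) X]
    [Module.Finite (IwasawaAlgebra p) X] (hX : Module.IsTorsion (IwasawaAlgebra p) X)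
    (Q : PowerSeries (PadicComplexInt p))
    (hQ : Ideal.span {Q} ≤ (Module.charIdeal (IwasawaAlgebra p) X).map (PowerSeries.map (R1.toCpInt p))) :
    ∀ m < lambdaInvariant p X, ‖((PowerSeries.coeff m Q : PadicComplexInt p) : ℂ_[p])‖ < 1 := by
  obtain ⟨g₀, hchar, hg₀, hord⟩ := exists_charIdeal_eq_span_C_pow_mu_mul (p := p) X hX
  have hQmem : Q ∈ (Ideal.span {(PowerSeries.C ((p : ℤ_[p]) ^ muInvariant p X) : IwasawaAlgebra p) * g₀}).map
      (PowerSeries.map (R1.toCpInt p)) := by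
    rw [← hchar]
    exact hQ (Ideal.mem_span_singleton_self Q)
  have h1 := le_order_map_residue_of_mem_map_span (R1.toCpInt p) (toCpInt_mem_maximalIdeal_iff (p := p)) hQmem
  have h2 : (lambdaInvariant p X : ℕ∞) ≤
      (PowerSeries.map (residue ℤ_[p]) ((PowerSeries.C ((p : ℤ_[p]) ^ muInvariant p X) : IwasawaAlgebra p) * g₀)).order := by
    rw [map_mul, ← hord]
    exact le_trans le_add_self (PowerSeries.le_order_mul _ _)
  intro m hm
  have hlt : (m : ℕ∞) < (PowerSeries.map (residue (PadicComplexInt p)) Q).order :=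
    lt_of_lt_of_le (by exact_mod_cast hm) (le_trans h2 h1)
  exact (norm_lt_one_iff_mem_maximalIdeal _).mpr
    (Literature.RingTheory.PowerSeries.coeff_mem_maximalIdeal_of_lt_order_map_residue hlt)

/-- **(AN) ⟸ the Greenberg–Vatsal comparison data** (pure residual-order arithmetic): if `Q ≡ u·L₁·L₂ (mod 𝔪)` with `u` a
unit, `ord L̄₁ ≥ n₁`, `ord L̄₂ ≥ n₂` and `λ(X) ≤ n₁ + n₂`, then the first `λ(X)` coefficients of `Q` are non-units
(`ord Q̄ = ord L̄₁ + ord L̄₂`, w2 g3's `order_map_residue_eq_add_of_congr_unit_mul`). `X` enters only through the number `λ(X)`.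
[cite: GreenbergVatsal2000, Thm. (1.3) and (17)] [cite: CastellaGrossiLeeSkinner2022, §3.3 (arXiv:2008.02571)] -/
theorem coeff_norm_lt_one_of_congr_of_order_bounds {lam : ℕ} {Q u L₁ L₂ : PowerSeries (PadicComplexInt p)}
    (hu : IsUnit u) (hcong : ∀ n, PowerSeries.coeff n Q - PowerSeries.coeff n (u * L₁ * L₂) ∈ maximalIdeal (PadicComplexInt p))
    {n₁ n₂ : ℕ} (h₁ : (n₁ : ℕ∞) ≤ (PowerSeries.map (residue (PadicComplexInt p)) L₁).order)
    (h₂ : (n₂ : ℕ∞) ≤ (PowerSeries.map (residue (PadicComplexInt p)) L₂).order) (hlam : lam ≤ n₁ + n₂) :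
    ∀ m < lam, ‖((PowerSeries.coeff m Q : PadicComplexInt p) : ℂ_[p])‖ < 1 := by
  have hord := Literature.RingTheory.PowerSeries.order_map_residue_eq_add_of_congr_unit_mul hu hcong
  intro m hm
  have hle : ((n₁ + n₂ : ℕ) : ℕ∞) ≤ (PowerSeries.map (residue (PadicComplexInt p)) Q).order := by
    rw [hord, Nat.cast_add]
    exact add_le_add h₁ h₂
  have hlt : (m : ℕ∞) < (PowerSeries.map (residue (PadicComplexInt p)) Q).order :=
    lt_of_lt_of_le (by exact_mod_cast lt_of_lt_of_le hm hlam) hle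
  exact (norm_lt_one_iff_mem_maximalIdeal _).mpr
    (Literature.RingTheory.PowerSeries.coeff_mem_maximalIdeal_of_lt_order_map_residue hlt)

end Upper

/-! ## §3 On the crux binders: the registered (AN) stub from the upper inclusion / from the GV data; the IMC equality -/

/-- **REGISTERED `stub_analyticInequality_cmRamified` (v4, VERBATIM) ⟸ CGLS Prop. 14 ∧ the UPPER ♭-(∅,0) inclusion
`(Q) ⊆ Ch_Λ(X_(∅,0))·𝓞_{ℂ_p}⟦T⟧` at every frame** (the Euler-system direction of the main conjecture for `f_W/K''`; research —
no bounded Λ-adic Heegner class at `a_p = 0`, barrier (C)). Torsion and finite generation of `X_(∅,0)` from p625055 / p621566; then §2.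
So (AN) is implied by, and strictly weaker than, the upper inclusion. [cite: CastellaGrossiLeeSkinner2022, Thm. 3.2.1 and proof of Thm. 5.1.1 (arXiv:2008.02571 pp. 4, 23)]
[cite: Washington1997, §13.2] -/
theorem stub_analyticInequality_cmRamified_of_prop14_of_upperIncl
    (hfact : CastellaGrossiLeeSkinner2022.prop14_residualCharacterSelmer_finite)
    (hupper : ∀ (p : ℕ) [Fact p.Prime] (W : WeierstrassCurve ℚ) [W.IsElliptic] [W.IsGloballyMinimal],
      W.HasCM → CMRamified W p → 5 ≤ p → W.analyticRank = 1 →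
      ∀ (N : ℕ) [NeZero N] (K : Type) [Field K] [NumberField K] (Dt : ModularParametrizationData W N),
      W.conductorNorm ℤ = N → IsImaginaryQuadratic K → SatisfiesHeegnerHypothesis N K →
      ∀ (κ : ZpExtension K p), κ.IsAnticyclotomic → ∀ (γ : Field.absoluteGaloisGroup K) [Fact (κ.IsTopGenerator γ)]
        (𝔭 : HeightOneSpectrum (𝓞 K)), ((p : ℕ) : 𝓞 K) ∈ 𝔭.asIdeal → 𝔭.asIdeal.ramificationIdx (𝓞 ℚ) = 1 →
        𝔭.asIdeal.inertiaDeg (𝓞 ℚ) = 1 → ∀ (𝔭' : HeightOneSpectrum (𝓞 K)), ((p : ℕ) : 𝓞 K) ∈ 𝔭'.asIdeal → 𝔭' ≠ 𝔭 →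
        ∀ (ι' : PadicAlgCl p ≃+* ℂ), SchneiderFree.BranchInducesPrime p ι' 𝔭 →
        ∀ (ΩK : ℂ) (Ωp : ℂ_[p]) (Q : PowerSeries (PadicComplexInt p)), ΩK ≠ 0 → Ωp ≠ 0 →
          R1.IsBDPLFunctionInt p ι' 𝔭 κ γ Dt.f ΩK Ωp Q →
          Ideal.span {Q} ≤ (XAc.charIdeal (W.baseChange K) p κ 𝔭' ∅ γ).map (PowerSeries.map (R1.toCpInt p))) :
    ∀ (p : ℕ) [Fact p.Prime] (W : WeierstrassCurve ℚ) [W.IsElliptic] [W.IsGloballyMinimal],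
      W.HasCM → CMRamified W p → 5 ≤ p → W.analyticRank = 1 →
      ∀ (N : ℕ) [NeZero N] (K : Type) [Field K] [NumberField K] (Dt : ModularParametrizationData W N),
      W.conductorNorm ℤ = N → IsImaginaryQuadratic K → SatisfiesHeegnerHypothesis N K →
      ∀ (κ : ZpExtension K p), κ.IsAnticyclotomic → ∀ (γ : Field.absoluteGaloisGroup K) [Fact (κ.IsTopGenerator γ)]
        (𝔭 : HeightOneSpectrum (𝓞 K)), ((p : ℕ) : 𝓞 K) ∈ 𝔭.asIdeal → 𝔭.asIdeal.ramificationIdx (𝓞 ℚ) = 1 →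
        𝔭.asIdeal.inertiaDeg (𝓞 ℚ) = 1 → ∀ (𝔭' : HeightOneSpectrum (𝓞 K)), ((p : ℕ) : 𝓞 K) ∈ 𝔭'.asIdeal → 𝔭' ≠ 𝔭 →
        ∀ (ι' : PadicAlgCl p ≃+* ℂ), SchneiderFree.BranchInducesPrime p ι' 𝔭 →
        ∀ (ΩK : ℂ) (Ωp : ℂ_[p]) (Q : PowerSeries (PadicComplexInt p)), ΩK ≠ 0 → Ωp ≠ 0 →
          R1.IsBDPLFunctionInt p ι' 𝔭 κ γ Dt.f ΩK Ωp Q →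
          ∀ m < lambdaInvariant p (XAc (W.baseChange K) p κ 𝔭' ∅ γ),
            ‖((PowerSeries.coeff m Q : PadicComplexInt p) : ℂ_[p])‖ < 1 := by
  intro p _ W _ _ hCM hram h5 hr N _ K _ _ Dt hN hK hHN κ hκ γ _ 𝔭 h𝔭 he hf 𝔭' h𝔭' hne ι' hind ΩK Ωp Q hΩK hΩp hBDP
  have hle := hupper p W hCM hram h5 hr N K Dt hN hK hHN κ hκ γ 𝔭 h𝔭 he hf 𝔭' h𝔭' hne ι' hind ΩK Ωp Q hΩK hΩp hBDP
  have htors := stub_torsion_cmRamified_of_prop14 hfact p W hCM hram h5 hr N K hN hK hHN κ hκ γ 𝔭 h𝔭 he hf 𝔭' h𝔭' hne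
  haveI : (W.baseChange K).IsElliptic := by rw [WeierstrassCurve.baseChange]; infer_instance
  haveI := moduleFinite_XAc_empty (W.baseChange K) κ 𝔭' γ (p := p)
  exact coeff_norm_lt_one_of_span_le_map_charIdeal (XAc (W.baseChange K) p κ 𝔭' ∅ γ) htors Q hle

/-- **REGISTERED `stub_analyticInequality_cmRamified` (v4, VERBATIM) ⟸ the Greenberg–Vatsal comparison data at every frame**:
a congruence `Q ≡ u·L₁·L₂ (mod 𝔪)` of the ♭-BDP frame with a unit times two auxiliary power series (e.g. Katz–character
functions of `χ_d ω^{(p+1)/4}`, `χ_d ω^{(3p−1)/4}` over `K''` — the (an-inv) congruence, Kriz–Li shape), residual-order bounds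
`ord L̄ᵢ ≥ nᵢ` (e.g. from the `GL₁` main conjecture over the `p`-split `K''`: `char(X_θᵢ) ∋ Lᵢ` with `nᵢ = λ(X_θᵢ)`), and the algebraic
inequality `λ(X_(∅,0)) ≤ n₁ + n₂` (the (alg-inv) devissage). No named fact is used: the three inputs are displayed as ONE
per-frame hypothesis. [cite: GreenbergVatsal2000, Thm. (1.3) and (17)] [cite: CastellaGrossiLeeSkinner2022, Thm. 3.2.1, §3.3 (arXiv:2008.02571)] -/
theorem stub_analyticInequality_cmRamified_of_GV
    (hGV : ∀ (p : ℕ) [Fact p.Prime] (W : WeierstrassCurve ℚ) [W.IsElliptic] [W.IsGloballyMinimal],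
      W.HasCM → CMRamified W p → 5 ≤ p → W.analyticRank = 1 →
      ∀ (N : ℕ) [NeZero N] (K : Type) [Field K] [NumberField K] (Dt : ModularParametrizationData W N),
      W.conductorNorm ℤ = N → IsImaginaryQuadratic K → SatisfiesHeegnerHypothesis N K →
      ∀ (κ : ZpExtension K p), κ.IsAnticyclotomic → ∀ (γ : Field.absoluteGaloisGroup K) [Fact (κ.IsTopGenerator γ)]
        (𝔭 : HeightOneSpectrum (𝓞 K)), ((p : ℕ) : 𝓞 K) ∈ 𝔭.asIdeal → 𝔭.asIdeal.ramificationIdx (𝓞 ℚ) = 1 →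
        𝔭.asIdeal.inertiaDeg (𝓞 ℚ) = 1 → ∀ (𝔭' : HeightOneSpectrum (𝓞 K)), ((p : ℕ) : 𝓞 K) ∈ 𝔭'.asIdeal → 𝔭' ≠ 𝔭 →
        ∀ (ι' : PadicAlgCl p ≃+* ℂ), SchneiderFree.BranchInducesPrime p ι' 𝔭 →
        ∀ (ΩK : ℂ) (Ωp : ℂ_[p]) (Q : PowerSeries (PadicComplexInt p)), ΩK ≠ 0 → Ωp ≠ 0 →
          R1.IsBDPLFunctionInt p ι' 𝔭 κ γ Dt.f ΩK Ωp Q →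
          ∃ (u L₁ L₂ : PowerSeries (PadicComplexInt p)) (n₁ n₂ : ℕ), IsUnit u ∧
            (∀ n, PowerSeries.coeff n Q - PowerSeries.coeff n (u * L₁ * L₂) ∈ maximalIdeal (PadicComplexInt p)) ∧
            (n₁ : ℕ∞) ≤ (PowerSeries.map (residue (PadicComplexInt p)) L₁).order ∧
            (n₂ : ℕ∞) ≤ (PowerSeries.map (residue (PadicComplexInt p)) L₂).order ∧
            lambdaInvariant p (XAc (W.baseChange K) p κ 𝔭' ∅ γ) ≤ n₁ + n₂) :
    ∀ (p : ℕ) [Fact p.Prime] (W : WeierstrassCurve ℚ) [W.IsElliptic] [W.IsGloballyMinimal],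
      W.HasCM → CMRamified W p → 5 ≤ p → W.analyticRank = 1 →
      ∀ (N : ℕ) [NeZero N] (K : Type) [Field K] [NumberField K] (Dt : ModularParametrizationData W N),
      W.conductorNorm ℤ = N → IsImaginaryQuadratic K → SatisfiesHeegnerHypothesis N K →
      ∀ (κ : ZpExtension K p), κ.IsAnticyclotomic → ∀ (γ : Field.absoluteGaloisGroup K) [Fact (κ.IsTopGenerator γ)]
        (𝔭 : HeightOneSpectrum (𝓞 K)), ((p : ℕ) : 𝓞 K) ∈ 𝔭.asIdeal → 𝔭.asIdeal.ramificationIdx (𝓞 ℚ) = 1 →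
        𝔭.asIdeal.inertiaDeg (𝓞 ℚ) = 1 → ∀ (𝔭' : HeightOneSpectrum (𝓞 K)), ((p : ℕ) : 𝓞 K) ∈ 𝔭'.asIdeal → 𝔭' ≠ 𝔭 →
        ∀ (ι' : PadicAlgCl p ≃+* ℂ), SchneiderFree.BranchInducesPrime p ι' 𝔭 →
        ∀ (ΩK : ℂ) (Ωp : ℂ_[p]) (Q : PowerSeries (PadicComplexInt p)), ΩK ≠ 0 → Ωp ≠ 0 →
          R1.IsBDPLFunctionInt p ι' 𝔭 κ γ Dt.f ΩK Ωp Q →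
          ∀ m < lambdaInvariant p (XAc (W.baseChange K) p κ 𝔭' ∅ γ),
            ‖((PowerSeries.coeff m Q : PadicComplexInt p) : ℂ_[p])‖ < 1 := by
  intro p _ W _ _ hCM hram h5 hr N _ K _ _ Dt hN hK hHN κ hκ γ _ 𝔭 h𝔭 he hf 𝔭' h𝔭' hne ι' hind ΩK Ωp Q hΩK hΩp hBDP
  obtain ⟨u, L₁, L₂, n₁, n₂, hu, hcong, h₁, h₂, hlam⟩ :=
    hGV p W hCM hram h5 hr N K Dt hN hK hHN κ hκ γ 𝔭 h𝔭 he hf 𝔭' h𝔭' hne ι' hind ΩK Ωp Q hΩK hΩp hBDP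
  exact coeff_norm_lt_one_of_congr_of_order_bounds hu hcong h₁ h₂ hlam

/-- **The ♭-(∅,0) IMC EQUALITY on the CM-ramified rows, at every frame, ⟸ CGLS Prop. 14 ∧ β1 ∧ (AN)** — the `hEq` socket of the
row kernel `bsdp_of_flatIMCEq_of_control_of_twist_row`, by name: `Ch_Λ(X_(∅,0))·𝓞_{ℂ_p}⟦T⟧ = (Q)`. Lower inclusion = β1 (with its
torsion guard discharged by `stub_torsion_cmRamified_of_prop14`); upper inclusion = the upgraded match
(`stub_invariantUpgrade_of_invariantMatch` ∘ `stub_invariantMatch_cmRamified_of_line_of_analyticInequality` fed with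
`lineData_cmRamified_of_prop14`). CONDITIONAL; BSD is not proved by any of this.
[cite: CastellaGrossiLeeSkinner2022, Thm. 3.2.1 and proof of Thm. 5.1.1 (arXiv:2008.02571 pp. 4, 23)] [cite: GreenbergVatsal2000, Thm. 1.3] -/
theorem flatIMCEq_cmRamified_of_prop14_of_flatIncl_of_analyticInequality
    (hfact : CastellaGrossiLeeSkinner2022.prop14_residualCharacterSelmer_finite)
    (h1 : ∀ (p : ℕ) [Fact p.Prime] (W : WeierstrassCurve ℚ) [W.IsElliptic] [W.IsGloballyMinimal],
      W.HasCM → CMRamified W p → 5 ≤ p → W.analyticRank = 1 →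
      ∀ (N : ℕ) [NeZero N] (K : Type) [Field K] [NumberField K] (Dt : ModularParametrizationData W N),
      W.conductorNorm ℤ = N → IsImaginaryQuadratic K → SatisfiesHeegnerHypothesis N K →
      ∀ (κ : ZpExtension K p), κ.IsAnticyclotomic → ∀ (γ : Field.absoluteGaloisGroup K) [Fact (κ.IsTopGenerator γ)]
        (𝔭 : HeightOneSpectrum (𝓞 K)), ((p : ℕ) : 𝓞 K) ∈ 𝔭.asIdeal → 𝔭.asIdeal.ramificationIdx (𝓞 ℚ) = 1 →
        𝔭.asIdeal.inertiaDeg (𝓞 ℚ) = 1 → ∀ (𝔭' : HeightOneSpectrum (𝓞 K)), ((p : ℕ) : 𝓞 K) ∈ 𝔭'.asIdeal → 𝔭' ≠ 𝔭 →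
        ∀ (ι' : PadicAlgCl p ≃+* ℂ), SchneiderFree.BranchInducesPrime p ι' 𝔭 →
        ∀ (ΩK : ℂ) (Ωp : ℂ_[p]) (Q : PowerSeries (PadicComplexInt p)), ΩK ≠ 0 → Ωp ≠ 0 →
          R1.IsBDPLFunctionInt p ι' 𝔭 κ γ Dt.f ΩK Ωp Q →
          Module.IsTorsion (IwasawaAlgebra p) (XAc (W.baseChange K) p κ 𝔭' ∅ γ) →
          (XAc.charIdeal (W.baseChange K) p κ 𝔭' ∅ γ).map (PowerSeries.map (R1.toCpInt p)) ≤ Ideal.span {Q})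
    (han : ∀ (p : ℕ) [Fact p.Prime] (W : WeierstrassCurve ℚ) [W.IsElliptic] [W.IsGloballyMinimal],
      W.HasCM → CMRamified W p → 5 ≤ p → W.analyticRank = 1 →
      ∀ (N : ℕ) [NeZero N] (K : Type) [Field K] [NumberField K] (Dt : ModularParametrizationData W N),
      W.conductorNorm ℤ = N → IsImaginaryQuadratic K → SatisfiesHeegnerHypothesis N K →
      ∀ (κ : ZpExtension K p), κ.IsAnticyclotomic → ∀ (γ : Field.absoluteGaloisGroup K) [Fact (κ.IsTopGenerator γ)]
        (𝔭 : HeightOneSpectrum (𝓞 K)), ((p : ℕ) : 𝓞 K) ∈ 𝔭.asIdeal → 𝔭.asIdeal.ramificationIdx (𝓞 ℚ) = 1 →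
        𝔭.asIdeal.inertiaDeg (𝓞 ℚ) = 1 → ∀ (𝔭' : HeightOneSpectrum (𝓞 K)), ((p : ℕ) : 𝓞 K) ∈ 𝔭'.asIdeal → 𝔭' ≠ 𝔭 →
        ∀ (ι' : PadicAlgCl p ≃+* ℂ), SchneiderFree.BranchInducesPrime p ι' 𝔭 →
        ∀ (ΩK : ℂ) (Ωp : ℂ_[p]) (Q : PowerSeries (PadicComplexInt p)), ΩK ≠ 0 → Ωp ≠ 0 →
          R1.IsBDPLFunctionInt p ι' 𝔭 κ γ Dt.f ΩK Ωp Q →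
          ∀ m < lambdaInvariant p (XAc (W.baseChange K) p κ 𝔭' ∅ γ),
            ‖((PowerSeries.coeff m Q : PadicComplexInt p) : ℂ_[p])‖ < 1) :
    ∀ (p : ℕ) [Fact p.Prime] (W : WeierstrassCurve ℚ) [W.IsElliptic] [W.IsGloballyMinimal],
      W.HasCM → CMRamified W p → 5 ≤ p → W.analyticRank = 1 →
      ∀ (N : ℕ) [NeZero N] (K : Type) [Field K] [NumberField K] (Dt : ModularParametrizationData W N),
      W.conductorNorm ℤ = N → IsImaginaryQuadratic K → SatisfiesHeegnerHypothesis N K →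
      ∀ (κ : ZpExtension K p), κ.IsAnticyclotomic → ∀ (γ : Field.absoluteGaloisGroup K) [Fact (κ.IsTopGenerator γ)]
        (𝔭 : HeightOneSpectrum (𝓞 K)), ((p : ℕ) : 𝓞 K) ∈ 𝔭.asIdeal → 𝔭.asIdeal.ramificationIdx (𝓞 ℚ) = 1 →
        𝔭.asIdeal.inertiaDeg (𝓞 ℚ) = 1 → ∀ (𝔭' : HeightOneSpectrum (𝓞 K)), ((p : ℕ) : 𝓞 K) ∈ 𝔭'.asIdeal → 𝔭' ≠ 𝔭 →
        ∀ (ι' : PadicAlgCl p ≃+* ℂ), SchneiderFree.BranchInducesPrime p ι' 𝔭 →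
        ∀ (ΩK : ℂ) (Ωp : ℂ_[p]) (Q : PowerSeries (PadicComplexInt p)), ΩK ≠ 0 → Ωp ≠ 0 →
          R1.IsBDPLFunctionInt p ι' 𝔭 κ γ Dt.f ΩK Ωp Q →
          (XAc.charIdeal (W.baseChange K) p κ 𝔭' ∅ γ).map (PowerSeries.map (R1.toCpInt p)) = Ideal.span {Q} := by
  intro p _ W _ _ hCM hram h5 hr N _ K _ _ Dt hN hK hHN κ hκ γ _ 𝔭 h𝔭 he hf 𝔭' h𝔭' hne ι' hind ΩK Ωp Q hΩK hΩp hBDP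
  have htors := stub_torsion_cmRamified_of_prop14 hfact p W hCM hram h5 hr N K hN hK hHN κ hκ γ 𝔭 h𝔭 he hf 𝔭' h𝔭' hne
  have hlow := h1 p W hCM hram h5 hr N K Dt hN hK hHN κ hκ γ 𝔭 h𝔭 he hf 𝔭' h𝔭' hne ι' hind ΩK Ωp Q hΩK hΩp hBDP htors
  have hmatch := stub_invariantMatch_cmRamified_of_line_of_analyticInequality
    (fun p _ W _ _ hCM hram h5 _ N _ K _ _ _ hN hK hHN κ hκ _ _ _ _ _ _ 𝔭' h𝔭' _ _ _ _ _ _ _ _ _ ↦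
      lineData_cmRamified_of_prop14 hfact p W hCM hram h5 N K hN hK hHN κ hκ 𝔭' h𝔭') han
  exact le_antisymm hlow (stub_invariantUpgrade_of_invariantMatch hmatch p W hCM hram h5 hr N K Dt hN hK hHN κ hκ γ 𝔭 h𝔭
    he hf 𝔭' h𝔭' hne ι' hind ΩK Ωp Q hΩK hΩp hBDP hlow)


/-! ## §4 (LEAD g4 append) No loss in the v4/v5 reshape: {β1, (AN)} ⟸ the ♭-IMC equality, frame by frame -/

/-- **Converse bookkeeping: the ♭-(∅,0) IMC EQUALITY at every frame gives back BOTH registered research stubs** — β1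
(`stub_flatEisensteinIncl_cmRamified`, v3/v4/v5 VERBATIM: the lower inclusion is half of the equality; its `IsTorsion` guard is not
even used) and (AN) (`stub_analyticInequality_cmRamified`, v4/v5 VERBATIM: from the upper half by §2, with torsion from CGLS Prop. 14).
Together with `flatIMCEq_cmRamified_of_prop14_of_flatIncl_of_analyticInequality`: modulo the print stub, {β1 ∧ (AN)} ⟺ the `hEq`
socket of the row kernel — the reshape v3 → v4/v5 loses and adds nothing. [cite: CastellaGrossiLeeSkinner2022, Thm. 3.2.1 (arXiv:2008.02571 p. 4)]
[cite: GreenbergVatsal2000, Thm. 1.3] -/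
theorem flatIncl_and_analyticInequality_of_prop14_of_flatIMCEq
    (hfact : CastellaGrossiLeeSkinner2022.prop14_residualCharacterSelmer_finite)
    (heq : ∀ (p : ℕ) [Fact p.Prime] (W : WeierstrassCurve ℚ) [W.IsElliptic] [W.IsGloballyMinimal],
      W.HasCM → CMRamified W p → 5 ≤ p → W.analyticRank = 1 →
      ∀ (N : ℕ) [NeZero N] (K : Type) [Field K] [NumberField K] (Dt : ModularParametrizationData W N),
      W.conductorNorm ℤ = N → IsImaginaryQuadratic K → SatisfiesHeegnerHypothesis N K →
      ∀ (κ : ZpExtension K p), κ.IsAnticyclotomic → ∀ (γ : Field.absoluteGaloisGroup K) [Fact (κ.IsTopGenerator γ)]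
        (𝔭 : HeightOneSpectrum (𝓞 K)), ((p : ℕ) : 𝓞 K) ∈ 𝔭.asIdeal → 𝔭.asIdeal.ramificationIdx (𝓞 ℚ) = 1 →
        𝔭.asIdeal.inertiaDeg (𝓞 ℚ) = 1 → ∀ (𝔭' : HeightOneSpectrum (𝓞 K)), ((p : ℕ) : 𝓞 K) ∈ 𝔭'.asIdeal → 𝔭' ≠ 𝔭 →
        ∀ (ι' : PadicAlgCl p ≃+* ℂ), SchneiderFree.BranchInducesPrime p ι' 𝔭 →
        ∀ (ΩK : ℂ) (Ωp : ℂ_[p]) (Q : PowerSeries (PadicComplexInt p)), ΩK ≠ 0 → Ωp ≠ 0 →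
          R1.IsBDPLFunctionInt p ι' 𝔭 κ γ Dt.f ΩK Ωp Q →
          (XAc.charIdeal (W.baseChange K) p κ 𝔭' ∅ γ).map (PowerSeries.map (R1.toCpInt p)) = Ideal.span {Q}) :
    (∀ (p : ℕ) [Fact p.Prime] (W : WeierstrassCurve ℚ) [W.IsElliptic] [W.IsGloballyMinimal],
      W.HasCM → CMRamified W p → 5 ≤ p → W.analyticRank = 1 →
      ∀ (N : ℕ) [NeZero N] (K : Type) [Field K] [NumberField K] (Dt : ModularParametrizationData W N),
      W.conductorNorm ℤ = N → IsImaginaryQuadratic K → SatisfiesHeegnerHypothesis N K →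
      ∀ (κ : ZpExtension K p), κ.IsAnticyclotomic → ∀ (γ : Field.absoluteGaloisGroup K) [Fact (κ.IsTopGenerator γ)]
        (𝔭 : HeightOneSpectrum (𝓞 K)), ((p : ℕ) : 𝓞 K) ∈ 𝔭.asIdeal → 𝔭.asIdeal.ramificationIdx (𝓞 ℚ) = 1 →
        𝔭.asIdeal.inertiaDeg (𝓞 ℚ) = 1 → ∀ (𝔭' : HeightOneSpectrum (𝓞 K)), ((p : ℕ) : 𝓞 K) ∈ 𝔭'.asIdeal → 𝔭' ≠ 𝔭 →
        ∀ (ι' : PadicAlgCl p ≃+* ℂ), SchneiderFree.BranchInducesPrime p ι' 𝔭 →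
        ∀ (ΩK : ℂ) (Ωp : ℂ_[p]) (Q : PowerSeries (PadicComplexInt p)), ΩK ≠ 0 → Ωp ≠ 0 →
          R1.IsBDPLFunctionInt p ι' 𝔭 κ γ Dt.f ΩK Ωp Q →
          Module.IsTorsion (IwasawaAlgebra p) (XAc (W.baseChange K) p κ 𝔭' ∅ γ) →
          (XAc.charIdeal (W.baseChange K) p κ 𝔭' ∅ γ).map (PowerSeries.map (R1.toCpInt p)) ≤ Ideal.span {Q}) ∧
    (∀ (p : ℕ) [Fact p.Prime] (W : WeierstrassCurve ℚ) [W.IsElliptic] [W.IsGloballyMinimal],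
      W.HasCM → CMRamified W p → 5 ≤ p → W.analyticRank = 1 →
      ∀ (N : ℕ) [NeZero N] (K : Type) [Field K] [NumberField K] (Dt : ModularParametrizationData W N),
      W.conductorNorm ℤ = N → IsImaginaryQuadratic K → SatisfiesHeegnerHypothesis N K →
      ∀ (κ : ZpExtension K p), κ.IsAnticyclotomic → ∀ (γ : Field.absoluteGaloisGroup K) [Fact (κ.IsTopGenerator γ)]
        (𝔭 : HeightOneSpectrum (𝓞 K)), ((p : ℕ) : 𝓞 K) ∈ 𝔭.asIdeal → 𝔭.asIdeal.ramificationIdx (𝓞 ℚ) = 1 →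
        𝔭.asIdeal.inertiaDeg (𝓞 ℚ) = 1 → ∀ (𝔭' : HeightOneSpectrum (𝓞 K)), ((p : ℕ) : 𝓞 K) ∈ 𝔭'.asIdeal → 𝔭' ≠ 𝔭 →
        ∀ (ι' : PadicAlgCl p ≃+* ℂ), SchneiderFree.BranchInducesPrime p ι' 𝔭 →
        ∀ (ΩK : ℂ) (Ωp : ℂ_[p]) (Q : PowerSeries (PadicComplexInt p)), ΩK ≠ 0 → Ωp ≠ 0 →
          R1.IsBDPLFunctionInt p ι' 𝔭 κ γ Dt.f ΩK Ωp Q →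
          ∀ m < lambdaInvariant p (XAc (W.baseChange K) p κ 𝔭' ∅ γ),
            ‖((PowerSeries.coeff m Q : PadicComplexInt p) : ℂ_[p])‖ < 1) := by
  refine ⟨fun p _ W _ _ hCM hram h5 hr N _ K _ _ Dt hN hK hHN κ hκ γ _ 𝔭 h𝔭 he hf 𝔭' h𝔭' hne ι' hind ΩK Ωp Q hΩK hΩp hBDP _ ↦
      le_of_eq (heq p W hCM hram h5 hr N K Dt hN hK hHN κ hκ γ 𝔭 h𝔭 he hf 𝔭' h𝔭' hne ι' hind ΩK Ωp Q hΩK hΩp hBDP), ?_⟩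
  exact stub_analyticInequality_cmRamified_of_prop14_of_upperIncl hfact
    fun p _ W _ _ hCM hram h5 hr N _ K _ _ Dt hN hK hHN κ hκ γ _ 𝔭 h𝔭 he hf 𝔭' h𝔭' hne ι' hind ΩK Ωp Q hΩK hΩp hBDP ↦
      ge_of_eq (heq p W hCM hram h5 hr N K Dt hN hK hHN κ hκ γ 𝔭 h𝔭 he hf 𝔭' h𝔭' hne ι' hind ΩK Ωp Q hΩK hΩp hBDP)

end Summit.BirchSwinnertonDyer.BirchSwinnertonDyer.Theorems.PrintCFram.EisensteinResourceBdpLine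

end
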